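import Literature.MathematicalPhysics.QuantumFieldTheory.Balaban1983to89.B9RWSumsCompleteGeo9YNbr
import Literature.MathematicalPhysics.QuantumFieldTheory.Balaban1983to89.B9RWSumsDefinitePins

/-!
# `Balaban1983to89.B9RWSumsDefinitePinsNbr` — rows 13 ∕ 18 ∕ 19 of the N06 census as ONE face at def-Y's members, with the all-blocks
# constants DEFINITE and the (3.43)–(3.46) co-readings SITED ON THE METRIC NEIGHBOURHOOD of radius 2 (the `Nbr` twin of
# `B9RWSumsDefinitePinsRel`): the knit's binders reduced to two sign records, one block equivalence with its multiplicity ∕ saturation,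
# a neighbourhood count, an evaluation constant, and the operator-level schemas

T. Bałaban, *Propagators for lattice gauge theories in a background field*, Commun. Math. Phys. **99** (1985) 389–434
[`Balaban1985BackgroundPropagators`, "B9"], Thm 3.7 p. 409, Cor. 3.8 p. 410, Thm 3.10 pp. 415–416, Thm 3.1 p. 397 (*"There exist
positive constants B₀, δ₀, B₀(β), B′₀(ε), B′₀(ε,β) …"*), p. 397 (Δ̃(y)); [4] = T. Bałaban, *Propagators and renormalization transformations
for lattice gauge theories. II*, Commun. Math. Phys. **96** (1984) 223–250 [`Balaban1984PropagatorsII`], Lemma 2.1 pp. 233–234.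

statement-level skeleton of published theorems with citation tags; proofs where landed; nothing here is a claim about the
Yang–Mills mass gap

WHY THIS FILE.  The N06 knit at def-Y's instance folds rows 13∕18∕19 through `B9RWSumsDefinitePinsRel.rows131819_definite_geo9Y_rel` — whose
(3.43)–(3.46) co-reading binder classes `hl∕hH1∕hIR` (both sides) are the CLASS-SITED `Rel` schemas, not dischargeable at the record's Δ̃-sited
cut-offs and coordinate evaluation (`B9RWSumsReadsRelNegative.not_l2ReadsRel_evBK`; this seat's located obstructions (O1)∕(O2)).  THIS FILE is
the SAME face with those classes in the `Nbr` species (`L2ReadsNbr`∕`H1ReadsNbr`∕`InputReadsNbr`, observation radius 2, evaluation constant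
`Cev`) and two new instance data — the neighbourhood count `(nbr (geo9Y x) 2 y).card ≤ mN` and `0 ≤ Cev` — every other geometric input of the
neighbourhood engines being discharged by name at `geo9Y` (`B9RWSumsCompleteGeo9YNbr`); the multiplicities are absorbed by scaling ALL the
shared all-blocks constants by `nbrScale m mN Cev (ℓ+1) (delta1Y p q)` = (mN·m·Cev·L² + m·L + L)·e^{2δ₁} in the definite E-letters `E37YNbr` ∕
`E310YNbr` (δ₁ = `delta1Y p q` unchanged).

* §1 `nbrScale` (+ its order facts), ★ `E37YNbr`, ★ `E310YNbr` (pin targets for `(ops x).E37` ∕ `(ops x).E310`).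
* §2 ★★★ `rows131819_definite_geo9Y_nbr` — `Thm37Printed ∧ Cor38Printed ∧ Thm310Printed ∧ RWSumsYieldIneqs` at the `Nbr` E-letters from
  `hp hq`, the block-equivalence data, `mN`, `Cev`, and the operator-level inputs of both sides (binder classes VERBATIM the sibling's with
  the (3.43)–(3.46) co-readings swapped to `L2ReadsNbr`∕`H1ReadsNbr`∕`InputReadsNbr`).

HONEST SCOPE.  Definitions by choice (`nbrScale`, the two E-letters) and kernel bookkeeping; nothing of [B9] or [4] asserted; every remaining
hypothesis is operator-level, a co-reading schema, a letter, a count or a sign.  The three second-order L² lines keep this lineage's models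
(`Lap ∘ₗ G`, `D ∘ₗ G ∘ₗ Dstar`, `G ∘ₗ Lap`) pending their re-modelling per the lit-balaban desk answer of record (print's (3.46)₃₋₅ =
∇∇G, ∇G∇\*, G∇\*∇\*).  NOT a node discharge; count-neutral; one finite 𝕋^{d+1} programme at fixed ε — nothing continuum, nothing about the
mass gap.  Cell `pub-ymgap` (HUMAN RULING D-0062), Track A node N06 [B9], N06-ASSIGNMENT v1 bundle F6 (rows 18–19), seat `pub-ymgap-dag-n06-k`
(gen 8), 2026-08-27.
-/
namespace Literature.MathematicalPhysics.QuantumFieldTheory.Balaban1983to89.B9RWSumsDefinitePinsNbr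

open Literature.MathematicalPhysics.QuantumFieldTheory.Balaban1983to89
open Finset B6RandomWalk B9Thm34Ext B9Thm37Whole B9Cor38Whole B9Thm310Whole B9RowSum261Faces B9RowSum261DefiniteFaces
open B9Ineq349Whole B9RWSums343to347Whole B9PinMembersKLevelV1 B9GeoLemma21KLevelV1 B9RWSums347DefiniteFaces
open B9Thm37GlueCor36 B9Thm37Glue B9RWSums346Schur B9RWSums343Holder B9RWSums343HolderGp B9RWSums346Lap B9RWSums344Input
open B9RWSums344InputGp B9RWSums346Two B9RWSums346TwoGp B11SectG B9RWSumsCompleteGeo9Y B9RWSumsDefinitePins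
open B9CoRealizesRel B9RWSumsReadsRel B9RWSumsReadsNbr B9RWSumsAllBlocksNbr B9RWSumsCompleteGeo9YNbr

noncomputable section

/-! ## §1 The multiplicity scale and the definite E-letters of the `Nbr` face -/

/-- the scale by which the shared all-blocks constants absorb the class multiplicity m, the neighbourhood count mN, the evaluation constant Cev,
the level comparability L and the radius-2 shift e^{2δ}: `(mN·m·Cev·L² + m·L + L)·e^{2δ}` (≧ 1, ≧ m, ≧ each engine factor when L ≧ 1, Cev ≧ 0,
δ ≧ 0). [cite: Balaban1985BackgroundPropagators, Thm 3.1 p.397 («There exist positive constants B₀ …»), bookkeeping] -/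
def nbrScale (m mN : ℕ) (Cev L δ : ℝ) : ℝ := ((mN : ℝ) * m * Cev * L ^ 2 + m * L + L) * Real.exp (2 * δ)

/-- the order facts of the scale: it dominates 1, m and each engine factor (`mN·m·Cev·L²·e^{2δ}`, `m·L·e^{2δ}`, `e^{2δ}`, `L·e^{2δ}`) when
`0 ≤ Cev`, `1 ≤ L`, `0 ≤ δ`. [cite: Balaban1985BackgroundPropagators, Thm 3.1 p.397, bookkeeping] -/
theorem nbrScale_facts (m mN : ℕ) {Cev L δ : ℝ} (hCev : 0 ≤ Cev) (hL : 1 ≤ L) (hδ : 0 ≤ δ) :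
    1 ≤ nbrScale m mN Cev L δ ∧ (m : ℝ) ≤ nbrScale m mN Cev L δ ∧
      (mN : ℝ) * m * Cev * L ^ 2 * Real.exp (2 * δ) ≤ nbrScale m mN Cev L δ ∧
      (m : ℝ) * L * Real.exp (2 * δ) ≤ nbrScale m mN Cev L δ ∧ Real.exp (2 * δ) ≤ nbrScale m mN Cev L δ ∧
      L * Real.exp (2 * δ) ≤ nbrScale m mN Cev L δ := by
  have he1 : 1 ≤ Real.exp (2 * δ) := Real.one_le_exp (by positivity)
  have he0 : 0 ≤ Real.exp (2 * δ) := Real.exp_nonneg _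
  have hm0 : (0 : ℝ) ≤ m := Nat.cast_nonneg m
  have hL0 : 0 ≤ L := zero_le_one.trans hL
  have hA0 : 0 ≤ (mN : ℝ) * m * Cev * L ^ 2 := by positivity
  have hmL : 0 ≤ (m : ℝ) * L := mul_nonneg hm0 hL0
  have hLe : L * Real.exp (2 * δ) ≤ nbrScale m mN Cev L δ := by
    unfold nbrScale
    exact mul_le_mul_of_nonneg_right (by linarith [hA0, hmL]) he0
  have hLe1 : 1 ≤ L * Real.exp (2 * δ) := one_le_mul_of_one_le_of_one_le hL he1
  have he : Real.exp (2 * δ) ≤ nbrScale m mN Cev L δ := le_trans (le_mul_of_one_le_left he0 hL) hLe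
  have hmLe : (m : ℝ) * L * Real.exp (2 * δ) ≤ nbrScale m mN Cev L δ := by
    unfold nbrScale
    exact mul_le_mul_of_nonneg_right (by linarith [hA0, hL0]) he0
  have hAe : (mN : ℝ) * m * Cev * L ^ 2 * Real.exp (2 * δ) ≤ nbrScale m mN Cev L δ := by
    unfold nbrScale
    exact mul_le_mul_of_nonneg_right (by linarith [hmL, hL0]) he0
  refine ⟨he1.trans he, ?_, hAe, hmLe, he, hLe⟩
  calc (m : ℝ) = m * 1 := (mul_one _).symm
    _ ≤ m * (L * Real.exp (2 * δ)) := mul_le_mul_of_nonneg_left hLe1 hm0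
    _ = (m : ℝ) * L * Real.exp (2 * δ) := by ring
    _ ≤ nbrScale m mN Cev L δ := hmLe

/-- `lowerB_{G′} ≤ B1Y` (twin of the sibling's private lemma). [folklore] -/
private theorem lowerB_le_B1Y_left' (p q : PinPrims) (dp dFp dq dFq : ℕ) (L₀ : ℝ) :
    p.lowerB dp dFp p.N' L₀ ≤ B1Y p q dp dFp dq dFq L₀ :=
  (le_max_left _ _).trans (le_max_right _ _)

/-- `lowerB_G ≤ B1Y` (twin of the sibling's private lemma). [folklore] -/
private theorem lowerB_le_B1Y_right' (p q : PinPrims) (dp dFp dq dFq : ℕ) (L₀ : ℝ) :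
    q.lowerB dq dFq q.NF L₀ ≤ B1Y p q dp dFp dq dFq L₀ :=
  (le_max_right _ _).trans (le_max_right _ _)

/-- `C ≤ pinLowerB …`. [folklore] -/
private theorem le_pinLowerB₁' (C cF lapC twoC L₀ : ℝ) : C ≤ pinLowerB C cF lapC twoC L₀ :=
  (le_max_left _ _).trans ((le_max_left _ _).trans ((le_max_left _ _).trans (le_max_left _ _)))

/-- `C·L₀ ≤ pinLowerB …`. [folklore] -/
private theorem le_pinLowerB₂' (C cF lapC twoC L₀ : ℝ) : C * L₀ ≤ pinLowerB C cF lapC twoC L₀ :=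
  (le_max_right _ _).trans ((le_max_left _ _).trans ((le_max_left _ _).trans (le_max_left _ _)))

/-- `C·c_F·L₀⁴ ≤ pinLowerB …`. [folklore] -/
private theorem le_pinLowerB₃' (C cF lapC twoC L₀ : ℝ) : C * cF * L₀ ^ (4 : ℝ) ≤ pinLowerB C cF lapC twoC L₀ :=
  (le_max_right _ _).trans ((le_max_left _ _).trans (le_max_left _ _))

/-- `√(C·lapC)·L₀ ≤ pinLowerB …`. [folklore] -/
private theorem le_pinLowerB₄' (C cF lapC twoC L₀ : ℝ) : Real.sqrt (C * lapC) * L₀ ≤ pinLowerB C cF lapC twoC L₀ :=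
  (le_max_right _ _).trans (le_max_left _ _)

/-- `twoC ≤ pinLowerB …`. [folklore] -/
private theorem le_pinLowerB₅' (C cF lapC twoC L₀ : ℝ) : twoC ≤ pinLowerB C cF lapC twoC L₀ :=
  le_max_right _ _

section StageY

variable {d ℓ : ℕ} {hd : 1 ≤ d + 1} {hL : Odd (ℓ + 1) ∧ 1 < ℓ + 1} {b₀ b₁ : ℝ} {Mstar : ℕ}
variable [∀ x : MemberY d ℓ hd hL b₀ b₁ Mstar, Fintype (geo9Y x).Site]
  [∀ x : MemberY d ℓ hd hL b₀ b₁ Mstar, DecidableEq (geo9Y x).Site]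
variable {c35 : ℝ} {bg : MemberY d ℓ hd hL b₀ b₁ Mstar → B9.Backgrounds}

/-- ★ **THE DEFINITE E-LETTER OF THEOREM 3.7 ∕ COROLLARY 3.8 AT A MEMBER FOR THE `Nbr` FACE**: the sibling's `E37Y` with ALL the shared
constants B₁, B₀(·), B′₀(·), B′₀(·,·) scaled by `nbrScale m mN Cev (ℓ+1) (delta1Y p q)` (class multiplicity, neighbourhood count, evaluation
constant, level comparability and the radius-2 shift absorbed); δ₁ unchanged.  OURS (a pin target for `(ops x).E37`). [cite: Balaban1985BackgroundPropagators, Thm 3.7 (3.90) p.409 + Cor. 3.8 (3.93)–(3.94) p.410 + Thm 3.1 (3.42)–(3.47) pp.397–398] -/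
def E37YNbr (m mN : ℕ) (Cev : ℝ) (p q : PinPrims) {x : MemberY d ℓ hd hL b₀ b₁ Mstar} {X Y ι : Type} (𝔬 : Ops (geo9Y x) (bg x) X Y ι)
    (rd : WalkReading (geo9Y x) (bg x) X ι) (H : Prop) (K : B9.KernelFamily (geo9Y x) (bg x)) :
    B9.RWExpansion (geo9Y x) (bg x) :=
  E37AllOfOps
    (W38OfOps 𝔬 rd 1 H (p.C (exp261 (@geo9Y d ℓ hd hL b₀ b₁ Mstar) p.δ₀ p.α)) ((1 - 2 * p.α) * p.δ₀))
    𝔬 1 H (p.C (exp261 (@geo9Y d ℓ hd hL b₀ b₁ Mstar) p.δ₀ p.α)) ((1 - 2 * p.α) * p.δ₀) K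
    (nbrScale m mN Cev ((ℓ + 1 : ℕ) : ℝ) (delta1Y p q) * B1Y p q (exp261 (@geo9Y d ℓ hd hL b₀ b₁ Mstar) p.δ₀ p.α)
      (exp261 (@geo9Y d ℓ hd hL b₀ b₁ Mstar) ((1 - 2 * p.α) * p.δ₀) (1 - p.αF))
      (exp261 (@geo9Y d ℓ hd hL b₀ b₁ Mstar) q.δ₀ q.α)
      (exp261 (@geo9Y d ℓ hd hL b₀ b₁ Mstar) ((1 - 2 * q.α) * q.δ₀) (1 - q.αF)) ((ℓ + 1 : ℕ) : ℝ))
    (delta1Y p q)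
    (fun β => nbrScale m mN Cev ((ℓ + 1 : ℕ) : ℝ) (delta1Y p q) *
      BbetaY p q (exp261 (@geo9Y d ℓ hd hL b₀ b₁ Mstar) p.δ₀ p.α) (exp261 (@geo9Y d ℓ hd hL b₀ b₁ Mstar) q.δ₀ q.α) β)
    (fun ε => nbrScale m mN Cev ((ℓ + 1 : ℕ) : ℝ) (delta1Y p q) *
      BepsY p q (exp261 (@geo9Y d ℓ hd hL b₀ b₁ Mstar) p.δ₀ p.α) (exp261 (@geo9Y d ℓ hd hL b₀ b₁ Mstar) q.δ₀ q.α)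
        ((ℓ + 1 : ℕ) : ℝ) ε)
    (fun ε β => nbrScale m mN Cev ((ℓ + 1 : ℕ) : ℝ) (delta1Y p q) *
      BepsbetaY p q (exp261 (@geo9Y d ℓ hd hL b₀ b₁ Mstar) p.δ₀ p.α) (exp261 (@geo9Y d ℓ hd hL b₀ b₁ Mstar) q.δ₀ q.α)
        ((ℓ + 1 : ℕ) : ℝ) ε β)

/-- ★ **THE DEFINITE E-LETTER OF THEOREM 3.10 AT A MEMBER FOR THE `Nbr` FACE**: the sibling's `E310Y` with every shared constant scaled by
`nbrScale m mN Cev (ℓ+1) (delta1Y p q)`.  OURS (a pin target for `(ops x).E310`). [cite: Balaban1985BackgroundPropagators, Thm 3.10 (3.107)–(3.108) pp.415–416 + Thm 3.3 p.399] -/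
def E310YNbr (m mN : ℕ) (Cev : ℝ) (p q : PinPrims) {x : MemberY d ℓ hd hL b₀ b₁ Mstar} {X Y ι A : Type}
    (𝔬 : Ops310 (geo9Y x) (bg x) X Y ι A) (rd : WalkReading310 (geo9Y x) (bg x) X ι A) (H : Prop)
    (K : B9.KernelFamily (geo9Y x) (bg x)) : B9.RWExpansion (geo9Y x) (bg x) :=
  W310OfOps 𝔬 rd
    (ConvAll3107 𝔬 1 H (q.C (exp261 (@geo9Y d ℓ hd hL b₀ b₁ Mstar) q.δ₀ q.α)) ((1 - 2 * q.α) * q.δ₀) K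
      (nbrScale m mN Cev ((ℓ + 1 : ℕ) : ℝ) (delta1Y p q) * B1Y p q (exp261 (@geo9Y d ℓ hd hL b₀ b₁ Mstar) p.δ₀ p.α)
        (exp261 (@geo9Y d ℓ hd hL b₀ b₁ Mstar) ((1 - 2 * p.α) * p.δ₀) (1 - p.αF))
        (exp261 (@geo9Y d ℓ hd hL b₀ b₁ Mstar) q.δ₀ q.α)
        (exp261 (@geo9Y d ℓ hd hL b₀ b₁ Mstar) ((1 - 2 * q.α) * q.δ₀) (1 - q.αF)) ((ℓ + 1 : ℕ) : ℝ))
      (delta1Y p q)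
      (fun β => nbrScale m mN Cev ((ℓ + 1 : ℕ) : ℝ) (delta1Y p q) *
        BbetaY p q (exp261 (@geo9Y d ℓ hd hL b₀ b₁ Mstar) p.δ₀ p.α) (exp261 (@geo9Y d ℓ hd hL b₀ b₁ Mstar) q.δ₀ q.α) β)
      (fun ε => nbrScale m mN Cev ((ℓ + 1 : ℕ) : ℝ) (delta1Y p q) *
        BepsY p q (exp261 (@geo9Y d ℓ hd hL b₀ b₁ Mstar) p.δ₀ p.α) (exp261 (@geo9Y d ℓ hd hL b₀ b₁ Mstar) q.δ₀ q.α)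
          ((ℓ + 1 : ℕ) : ℝ) ε)
      (fun ε β => nbrScale m mN Cev ((ℓ + 1 : ℕ) : ℝ) (delta1Y p q) *
        BepsbetaY p q (exp261 (@geo9Y d ℓ hd hL b₀ b₁ Mstar) p.δ₀ p.α) (exp261 (@geo9Y d ℓ hd hL b₀ b₁ Mstar) q.δ₀ q.α)
          ((ℓ + 1 : ℕ) : ℝ) ε β))

/-! ## §2 ★★★ Rows 13 ∕ 18 ∕ 19 as ONE face at the definite `Nbr` E-letters -/

/-- ★★★ **ROWS 13 ∕ 18 ∕ 19 OF THE N06 CENSUS AT def-Y's MEMBERS WITH DEFINITE EXPANSION DATA, THE (3.43)–(3.46) CO-READINGS SITED ON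
THE METRIC NEIGHBOURHOOD OF RADIUS 2** — the `Nbr` form of `B9RWSumsDefinitePinsRel.rows131819_definite_geo9Y_rel` (whose class-sited
`L2ReadsRel`∕`H1ReadsRel`∕`InputReadsRel` binders are not dischargeable at the record, `B9RWSumsReadsRelNegative.not_l2ReadsRel_evBK`):
Theorem 3.7 ∧ Corollary 3.8 at `E37YNbr m mN Cev p q`, Theorem 3.10 at `E310YNbr m mN Cev p q` and the summation leaf for the pair, from the two
sign records, ONE block equivalence `Rel x` on each member's sites with class multiplicity ≦ m and Lʲη, d saturated on classes, the
neighbourhood count `(nbr (geo9Y x) 2 y).card ≤ mN`, the evaluation constant `0 ≤ Cev`, and the OPERATOR-LEVEL inputs of both sides exactly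
as in the sibling — with the co-readings `CoRealizesRel` (n06-l), `GlobReads`, `L2ReadsNbr`, `H1ReadsNbr`, `InputReadsNbr`.  Inside:
`thm37_cor38_complete_geo9Y_nbr` ∕ `thm310_complete_geo9Y_nbr` at B₁ := `nbrScale … · B1Y …`, δ₁ := `delta1Y p q`, B₀(·) := `nbrScale … ·
BbetaY …`, B′₀(·) := `nbrScale … · BepsY …`, B′₀(·,·) := `nbrScale … · BepsbetaY …`, and `rwSumsYieldIneqs_allPins`.  Nothing of print
asserted; NOT a node discharge.
[cite: Balaban1985BackgroundPropagators, Thm 3.7 p.409 + Cor. 3.8 p.410 + Thm 3.10 pp.415–416 + Thm 3.7 ⇒ Thm 3.1 p.410 + Thm 3.10 ⇒ Thm 3.3 p.416 + Cor. 3.6 p.408; Balaban1984PropagatorsII, (2.51)–(2.52) p.232 + Lemma 2.1 pp.233–234] -/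
theorem rows131819_definite_geo9Y_nbr {X Y ι PX PY XA YA ιA AA PXA PYA : MemberY d ℓ hd hL b₀ b₁ Mstar → Type}
    [∀ x, Fintype (X x)] [∀ x, DecidableEq (X x)] [∀ x, Fintype (Y x)] [∀ x, DecidableEq (Y x)] [∀ x, Fintype (ι x)]
    [∀ x, Fintype (PX x)] [∀ x, DecidableEq (PX x)] [∀ x, Fintype (PY x)] [∀ x, DecidableEq (PY x)]
    [∀ x, Fintype (XA x)] [∀ x, DecidableEq (XA x)] [∀ x, Fintype (YA x)] [∀ x, DecidableEq (YA x)] [∀ x, Fintype (ιA x)]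
    [∀ x, Fintype (AA x)] [∀ x, Fintype (PXA x)] [∀ x, DecidableEq (PXA x)] [∀ x, Fintype (PYA x)] [∀ x, DecidableEq (PYA x)]
    (p q : PinPrims) (hp : p.OK) (hq : q.OK) (hc : 0 < c35) (H : MemberY d ℓ hd hL b₀ b₁ Mstar → Prop)
    -- the block equivalence of the instance («same carrier block»), its multiplicity and saturation
    (Rel : ∀ x : MemberY d ℓ hd hL b₀ b₁ Mstar, (geo9Y x).Site → (geo9Y x).Site → Prop) [∀ x, DecidableRel (Rel x)] (m mN : ℕ)
    (Cev : ℝ) (hCev : 0 ≤ Cev)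
    (hRlen : ∀ x (a a' : (geo9Y x).Site), Rel x a a' → (geo9Y x).len a = (geo9Y x).len a')
    (hRd₁ : ∀ x (a a' b : (geo9Y x).Site), Rel x a a' → (geo9Y x).dist a b = (geo9Y x).dist a' b)
    (hRd₂ : ∀ x (a b b' : (geo9Y x).Site), Rel x b b' → (geo9Y x).dist a b = (geo9Y x).dist a b')
    (hmult : ∀ x (y' : (geo9Y x).Site), (Finset.univ.filter (fun y'' => Rel x y'' y')).card ≤ m)
    (hnbr : ∀ (x : MemberY d ℓ hd hL b₀ b₁ Mstar) (y : (geo9Y x).Site), (nbr (geo9Y x) 2 y).card ≤ mN)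
    -- the G′ side (Theorem 3.7 ∕ Corollary 3.8)
    (𝔬 : ∀ x : MemberY d ℓ hd hL b₀ b₁ Mstar, Ops (geo9Y x) (bg x) (X x) (Y x) (ι x))
    (rd : ∀ x : MemberY d ℓ hd hL b₀ b₁ Mstar, WalkReading (geo9Y x) (bg x) (X x) (ι x))
    (𝔭 : ∀ x : MemberY d ℓ hd hL b₀ b₁ Mstar, HolderProbes (geo9Y x) (bg x) (X x) (Y x) (PX x) (PY x))
    (bH : ∀ x : MemberY d ℓ hd hL b₀ b₁ Mstar, ℝ → BlockNorm (toB6 (geo9Y x) 1 (H x)) (Y x → ℝ))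
    (K : ∀ x : MemberY d ℓ hd hL b₀ b₁ Mstar, B9.KernelFamily (geo9Y x) (bg x))
    (ev : ∀ x : MemberY d ℓ hd hL b₀ b₁ Mstar, (geo9Y x).Loc → X x → ℝ)
    (evY : ∀ x : MemberY d ℓ hd hL b₀ b₁ Mstar, (geo9Y x).Loc → Y x → ℝ)
    (κ : MemberY d ℓ hd hL b₀ b₁ Mstar → Sizes) (SH SL SI S2 : ∀ x : MemberY d ℓ hd hL b₀ b₁ Mstar, ι x → Finset (geo9Y x).Site)
    (hst : ∀ x, StaticOK (𝔬 x) p.ρ p.Nc p.N' p.Cℓ (κ x)) (hκ : ∀ x, (κ x).Bounded p.Kc p.θ₀ p.Cℓ (geo9Y x).M)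
    (hrd : ∀ x, (rd x).OK (𝔬 x).blk) (hloc : ∀ x, Locality (𝔬 x) (rd x))
    (h36 : ∀ x, p.M₁ ≤ (geo9Y x).M → ∀ α₀ : ℝ, 0 < α₀ → c35 * (geo9Y x).M * α₀ ≤ p.a₁ →
      ∀ U : (bg x).Cfg, (bg x).Reg335 c35 α₀ U → Local342 (𝔬 x) 1 (H x) p.B₀ p.δ₀ U ∧ Identities (𝔬 x) 1 (H x) U)
    (h36H : ∀ x, p.M₁ ≤ (geo9Y x).M → ∀ α₀ : ℝ, 0 < α₀ → c35 * (geo9Y x).M * α₀ ≤ p.a₁ →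
      ∀ U : (bg x).Cfg, (bg x).Reg335 c35 α₀ U →
        HolderLegs37 (𝔬 x) (𝔭 x) 1 (H x) (SH x) p.Bl p.δ₀ U ∧ HolderV37 (𝔬 x) (𝔭 x) 1 (H x) p.Bt p.δ₀ U ∧
          LapLegs37 (𝔬 x) 1 (H x) (SL x) p.BL p.δ₀ U ∧
            InputLegs37 (𝔬 x) (𝔭 x) 1 (H x) (bH x) (SI x) p.BI p.BI2 p.δ₀ U ∧ FactorsInput37 (𝔬 x) 1 (H x) (bH x) p.θI p.δ₀ U ∧
              L2TwoLegs37 (𝔬 x) 1 (H x) (S2 x) p.B2 p.δ₀ U ∧ FactorsL2_37 (𝔬 x) 1 (H x) p.θ2 p.δ₀ U)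
    (hco0 : ∀ x U, CoRealizesRel (K x) 0 U (Rel x) (𝔬 x).blk (𝔬 x).blk (ev x) ((𝔬 x).Gp U))
    (hco1 : ∀ x U, CoRealizesRel (K x) 1 U (Rel x) (𝔬 x).blkY (𝔬 x).blk (ev x) ((𝔬 x).D U ∘ₗ (𝔬 x).Gp U))
    (hco2 : ∀ x U, CoRealizesRel (K x) 2 U (Rel x) (𝔬 x).blk (𝔬 x).blkY (evY x) ((𝔬 x).Gp U ∘ₗ (𝔬 x).Dstar U))
    (hco3 : ∀ x U, CoRealizesRel (K x) 3 U (Rel x) (𝔬 x).blk (𝔬 x).blk (ev x) ((𝔬 x).Lap U ∘ₗ (𝔬 x).Gp U))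
    (hgl0 : ∀ x U, GlobReads (K x) 0 U (𝔬 x).blk (𝔬 x).blk (ev x) ((𝔬 x).Gp U))
    (hgl1 : ∀ x U, GlobReads (K x) 1 U (𝔬 x).blkY (𝔬 x).blk (ev x) ((𝔬 x).D U ∘ₗ (𝔬 x).Gp U))
    (hgl2 : ∀ x U, GlobReads (K x) 2 U (𝔬 x).blk (𝔬 x).blkY (evY x) ((𝔬 x).Gp U ∘ₗ (𝔬 x).Dstar U))
    (hgl3 : ∀ x U, GlobReads (K x) 3 U (𝔬 x).blk (𝔬 x).blk (ev x) ((𝔬 x).Lap U ∘ₗ (𝔬 x).Gp U))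
    (hl0 : ∀ x U, L2ReadsNbr (R := 1) (H := H x) (K x) 0 U (Rel x) 2 Cev (𝔬 x).blk (𝔬 x).blk (ev x) ((𝔬 x).Gp U))
    (hl1 : ∀ x U, L2ReadsNbr (R := 1) (H := H x) (K x) 1 U (Rel x) 2 Cev (𝔬 x).blkY (𝔬 x).blk (ev x) ((𝔬 x).D U ∘ₗ (𝔬 x).Gp U))
    (hl2 : ∀ x U, L2ReadsNbr (R := 1) (H := H x) (K x) 2 U (Rel x) 2 Cev (𝔬 x).blk (𝔬 x).blkY (evY x) ((𝔬 x).Gp U ∘ₗ (𝔬 x).Dstar U))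
    (hl3 : ∀ x U, L2ReadsNbr (R := 1) (H := H x) (K x) 3 U (Rel x) 2 Cev (𝔬 x).blk (𝔬 x).blk (ev x) ((𝔬 x).Lap U ∘ₗ (𝔬 x).Gp U))
    (hl4 : ∀ x U, L2ReadsNbr (R := 1) (H := H x) (K x) 4 U (Rel x) 2 Cev (𝔬 x).blkY (𝔬 x).blkY (evY x)
      ((𝔬 x).D U ∘ₗ ((𝔬 x).Gp U ∘ₗ (𝔬 x).Dstar U)))
    (hl5 : ∀ x U, L2ReadsNbr (R := 1) (H := H x) (K x) 5 U (Rel x) 2 Cev (𝔬 x).blk (𝔬 x).blk (ev x) ((𝔬 x).Gp U ∘ₗ (𝔬 x).Lap U))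
    (hH1 : ∀ x U, H1ReadsNbr (K x) U (𝔭 x) (Rel x) 2 (𝔬 x).blk (𝔬 x).blkY (ev x) (evY x) ((𝔬 x).D U ∘ₗ (𝔬 x).Gp U)
      ((𝔬 x).Gp U ∘ₗ (𝔬 x).Dstar U))
    (hIR : ∀ x U, InputReadsNbr (K x) U (𝔭 x) (bH x) 2 (𝔬 x).blkY (evY x) ((𝔬 x).D U ∘ₗ ((𝔬 x).Gp U ∘ₗ (𝔬 x).Dstar U)))
    (hsym : ∀ x U, IsTransposePair ((𝔬 x).Gp U) ((𝔬 x).Gp U))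
    (htr : ∀ x U, IsTransposePair ((𝔬 x).D U ∘ₗ (𝔬 x).Gp U) ((𝔬 x).Gp U ∘ₗ (𝔬 x).Dstar U))
    (hadjL : ∀ x U, IsTransposePair ((𝔬 x).Lap U ∘ₗ (𝔬 x).Gp U) ((𝔬 x).Gp U ∘ₗ (𝔬 x).Lap U))
    (hcntH : ∀ x (a : (geo9Y x).Site), (∑ c, if a ∈ SH x c then (1 : ℝ) else 0) ≤ p.NH)
    (hcntL : ∀ x (a : (geo9Y x).Site), (∑ c, if a ∈ SL x c then (1 : ℝ) else 0) ≤ p.NL)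
    (hcntI : ∀ x (a : (geo9Y x).Site), (∑ c, if a ∈ SI x c then (1 : ℝ) else 0) ≤ p.NI)
    (hcnt2 : ∀ x (a : (geo9Y x).Site), (∑ c, if a ∈ S2 x c then (1 : ℝ) else 0) ≤ p.N2)
    -- the G side (Theorem 3.10)
    (𝔬A : ∀ x : MemberY d ℓ hd hL b₀ b₁ Mstar, Ops310 (geo9Y x) (bg x) (XA x) (YA x) (ιA x) (AA x))
    (rdA : ∀ x : MemberY d ℓ hd hL b₀ b₁ Mstar, WalkReading310 (geo9Y x) (bg x) (XA x) (ιA x) (AA x))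
    (𝔭A : ∀ x : MemberY d ℓ hd hL b₀ b₁ Mstar, HolderProbes (geo9Y x) (bg x) (XA x) (YA x) (PXA x) (PYA x))
    (bHA : ∀ x : MemberY d ℓ hd hL b₀ b₁ Mstar, ℝ → BlockNorm (toB6 (geo9Y x) 1 (H x)) (YA x → ℝ))
    (KA : ∀ x : MemberY d ℓ hd hL b₀ b₁ Mstar, B9.KernelFamily (geo9Y x) (bg x))
    (evA : ∀ x : MemberY d ℓ hd hL b₀ b₁ Mstar, (geo9Y x).Loc → XA x → ℝ)
    (evYA : ∀ x : MemberY d ℓ hd hL b₀ b₁ Mstar, (geo9Y x).Loc → YA x → ℝ)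
    (κA : MemberY d ℓ hd hL b₀ b₁ Mstar → Sizes310)
    (SHA SLA SIA S2A : ∀ x : MemberY d ℓ hd hL b₀ b₁ Mstar, ιA x → Finset (geo9Y x).Site)
    (hstA : ∀ x, StaticOK310 (𝔬A x) q.ρ q.Nc q.N' q.NF q.Cℓ (κA x)) (hκA : ∀ x, (κA x).Bounded q.Kc)
    (hrdA : ∀ x, (rdA x).OK (𝔬A x).blk) (hlocA : ∀ x, Locality310 (𝔬A x) (rdA x))
    (h36A : ∀ x, q.M₁ ≤ (geo9Y x).M → ∀ α₀ : ℝ, 0 < α₀ → c35 * (geo9Y x).M * α₀ ≤ q.a₁ →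
      ∀ U : (bg x).Cfg, (bg x).Reg335 c35 α₀ U →
        Local342G (𝔬A x) 1 (H x) q.B₀ q.δ₀ U ∧ B9Thm310Whole.Factors389 (𝔬A x) 1 (H x) q.θ₀ q.δ₀ U ∧
          Identities310 (𝔬A x) 1 (H x) U)
    (h36HA : ∀ x, q.M₁ ≤ (geo9Y x).M → ∀ α₀ : ℝ, 0 < α₀ → c35 * (geo9Y x).M * α₀ ≤ q.a₁ →
      ∀ U : (bg x).Cfg, (bg x).Reg335 c35 α₀ U →
        HolderLegs310 (𝔬A x) (𝔭A x) 1 (H x) (SHA x) q.Bl q.δ₀ U ∧ FactorsHolder310 (𝔬A x) (𝔭A x) 1 (H x) q.Bt q.δ₀ U ∧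
          LapLegs310 (𝔬A x) 1 (H x) (SLA x) q.BL q.δ₀ U ∧
            InputLegs310 (𝔬A x) (𝔭A x) 1 (H x) (bHA x) (SIA x) q.BI q.BI2 q.δ₀ U ∧
              FactorsInput310 (𝔬A x) 1 (H x) (bHA x) q.θI q.δ₀ U ∧
                L2TwoLegs310 (𝔬A x) 1 (H x) (S2A x) q.B2 q.δ₀ U ∧ FactorsL2_310 (𝔬A x) 1 (H x) q.θ2 q.δ₀ U)
    (hcoA0 : ∀ x U, CoRealizesRel (KA x) 0 U (Rel x) (𝔬A x).blk (𝔬A x).blk (evA x) ((𝔬A x).G U))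
    (hcoA1 : ∀ x U, CoRealizesRel (KA x) 1 U (Rel x) (𝔬A x).blkY (𝔬A x).blk (evA x) ((𝔬A x).D U ∘ₗ (𝔬A x).G U))
    (hcoA2 : ∀ x U, CoRealizesRel (KA x) 2 U (Rel x) (𝔬A x).blk (𝔬A x).blkY (evYA x) ((𝔬A x).G U ∘ₗ (𝔬A x).Dstar U))
    (hcoA3 : ∀ x U, CoRealizesRel (KA x) 3 U (Rel x) (𝔬A x).blk (𝔬A x).blk (evA x) ((𝔬A x).Lap U ∘ₗ (𝔬A x).G U))
    (hglA0 : ∀ x U, GlobReads (KA x) 0 U (𝔬A x).blk (𝔬A x).blk (evA x) ((𝔬A x).G U))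
    (hglA1 : ∀ x U, GlobReads (KA x) 1 U (𝔬A x).blkY (𝔬A x).blk (evA x) ((𝔬A x).D U ∘ₗ (𝔬A x).G U))
    (hglA2 : ∀ x U, GlobReads (KA x) 2 U (𝔬A x).blk (𝔬A x).blkY (evYA x) ((𝔬A x).G U ∘ₗ (𝔬A x).Dstar U))
    (hglA3 : ∀ x U, GlobReads (KA x) 3 U (𝔬A x).blk (𝔬A x).blk (evA x) ((𝔬A x).Lap U ∘ₗ (𝔬A x).G U))
    (hlA0 : ∀ x U, L2ReadsNbr (R := 1) (H := H x) (KA x) 0 U (Rel x) 2 Cev (𝔬A x).blk (𝔬A x).blk (evA x) ((𝔬A x).G U))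
    (hlA1 : ∀ x U, L2ReadsNbr (R := 1) (H := H x) (KA x) 1 U (Rel x) 2 Cev (𝔬A x).blkY (𝔬A x).blk (evA x) ((𝔬A x).D U ∘ₗ (𝔬A x).G U))
    (hlA2 : ∀ x U, L2ReadsNbr (R := 1) (H := H x) (KA x) 2 U (Rel x) 2 Cev (𝔬A x).blk (𝔬A x).blkY (evYA x) ((𝔬A x).G U ∘ₗ (𝔬A x).Dstar U))
    (hlA3 : ∀ x U, L2ReadsNbr (R := 1) (H := H x) (KA x) 3 U (Rel x) 2 Cev (𝔬A x).blk (𝔬A x).blk (evA x) ((𝔬A x).Lap U ∘ₗ (𝔬A x).G U))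
    (hlA4 : ∀ x U, L2ReadsNbr (R := 1) (H := H x) (KA x) 4 U (Rel x) 2 Cev (𝔬A x).blkY (𝔬A x).blkY (evYA x)
      ((𝔬A x).D U ∘ₗ ((𝔬A x).G U ∘ₗ (𝔬A x).Dstar U)))
    (hlA5 : ∀ x U, L2ReadsNbr (R := 1) (H := H x) (KA x) 5 U (Rel x) 2 Cev (𝔬A x).blk (𝔬A x).blk (evA x) ((𝔬A x).G U ∘ₗ (𝔬A x).Lap U))
    (hH1A : ∀ x U, H1ReadsNbr (KA x) U (𝔭A x) (Rel x) 2 (𝔬A x).blk (𝔬A x).blkY (evA x) (evYA x) ((𝔬A x).D U ∘ₗ (𝔬A x).G U)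
      ((𝔬A x).G U ∘ₗ (𝔬A x).Dstar U))
    (hIRA : ∀ x U, InputReadsNbr (KA x) U (𝔭A x) (bHA x) 2 (𝔬A x).blkY (evYA x) ((𝔬A x).D U ∘ₗ ((𝔬A x).G U ∘ₗ (𝔬A x).Dstar U)))
    (hsymA : ∀ x U, IsTransposePair ((𝔬A x).G U) ((𝔬A x).G U))
    (htrA : ∀ x U, IsTransposePair ((𝔬A x).D U ∘ₗ (𝔬A x).G U) ((𝔬A x).G U ∘ₗ (𝔬A x).Dstar U))
    (hadjLA : ∀ x U, IsTransposePair ((𝔬A x).Lap U ∘ₗ (𝔬A x).G U) ((𝔬A x).G U ∘ₗ (𝔬A x).Lap U))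
    (hcntHA : ∀ x (a : (geo9Y x).Site), (∑ c, if a ∈ SHA x c then (1 : ℝ) else 0) ≤ q.NH)
    (hcntLA : ∀ x (a : (geo9Y x).Site), (∑ c, if a ∈ SLA x c then (1 : ℝ) else 0) ≤ q.NL)
    (hcntIA : ∀ x (a : (geo9Y x).Site), (∑ c, if a ∈ SIA x c then (1 : ℝ) else 0) ≤ q.NI)
    (hcnt2A : ∀ x (a : (geo9Y x).Site), (∑ c, if a ∈ S2A x c then (1 : ℝ) else 0) ≤ q.N2) :
    B9.Thm37Printed c35 geo9Y bg (fun x => E37YNbr (bg := bg) m mN Cev p q (𝔬 x) (rd x) (H x) (K x)) ∧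
      B9.Cor38Printed c35 geo9Y bg (fun x => E37YNbr (bg := bg) m mN Cev p q (𝔬 x) (rd x) (H x) (K x)) ∧
      B9.Thm310Printed c35 geo9Y bg (fun x => E310YNbr (bg := bg) m mN Cev p q (𝔬A x) (rdA x) (H x) (KA x)) ∧
      B9.RWSumsYieldIneqs geo9Y bg (fun x => E37YNbr (bg := bg) m mN Cev p q (𝔬 x) (rd x) (H x) (K x))
        (fun x => E310YNbr (bg := bg) m mN Cev p q (𝔬A x) (rdA x) (H x) (KA x)) K KA := by
  set dp : ℕ := exp261 (@geo9Y d ℓ hd hL b₀ b₁ Mstar) p.δ₀ p.α with hdp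
  set dFp : ℕ := exp261 (@geo9Y d ℓ hd hL b₀ b₁ Mstar) ((1 - 2 * p.α) * p.δ₀) (1 - p.αF) with hdFp
  set dq : ℕ := exp261 (@geo9Y d ℓ hd hL b₀ b₁ Mstar) q.δ₀ q.α with hdq
  set dFq : ℕ := exp261 (@geo9Y d ℓ hd hL b₀ b₁ Mstar) ((1 - 2 * q.α) * q.δ₀) (1 - q.αF) with hdFq
  set L₀ : ℝ := ((ℓ + 1 : ℕ) : ℝ) with hL₀
  have hL₀0 : 0 ≤ L₀ := by rw [hL₀]; positivity
  have hBp := lowerB_le_B1Y_left' p q dp dFp dq dFq L₀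
  have hBq := lowerB_le_B1Y_right' p q dp dFp dq dFq L₀
  have hB1 : 0 ≤ B1Y p q dp dFp dq dFq L₀ := (B1Y_pos p q dp dFp dq dFq L₀).le
  -- the scale and its order facts
  have hδ1 : 0 < delta1Y p q := delta1Y_pos hp hq
  have he0 : 0 ≤ Real.exp (2 * delta1Y p q) := Real.exp_nonneg _
  have hL1 : (1 : ℝ) ≤ L₀ := by rw [hL₀]; exact_mod_cast Nat.succ_le_succ (Nat.zero_le ℓ)
  have hm0 : (0 : ℝ) ≤ m := Nat.cast_nonneg m
  obtain ⟨hs1, hsm, hsL2, hsmL, hse, hsLe⟩ := nbrScale_facts m mN hCev hL1 hδ1.le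
  set s : ℝ := nbrScale m mN Cev L₀ (delta1Y p q) with hsname
  have hs0 : (0 : ℝ) ≤ s := zero_le_one.trans hs1
  -- the scaled relations: k·X ≤ s·B for 0 ≤ k ≤ s, 0 ≤ X ≤ B; X ≤ s·B for X ≤ B, 0 ≤ B
  have scK : ∀ {k X B : ℝ}, 0 ≤ k → k ≤ s → 0 ≤ X → X ≤ B → k * X ≤ s * B := fun hk hks hX hXB =>
    mul_le_mul hks hXB hX hs0
  have sc0 : ∀ {X B : ℝ}, X ≤ B → 0 ≤ B → X ≤ s * B := fun hXB hB => hXB.trans (le_mul_of_one_le_left hB hs1)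
  have hmLe0 : 0 ≤ (m : ℝ) * L₀ * Real.exp (2 * delta1Y p q) := by positivity
  have hAe0 : 0 ≤ (mN : ℝ) * m * Cev * L₀ ^ 2 * Real.exp (2 * delta1Y p q) := by positivity
  have hLe0 : 0 ≤ L₀ * Real.exp (2 * delta1Y p q) := by positivity
  have hCp : 0 ≤ p.C dp := PinPrims.C_nonneg hp dp
  have hCq : 0 ≤ q.C dq := PinPrims.C_nonneg hq dq
  have hc1p : 0 ≤ B6.c1 dp p.δ₀ p.α := c1_nonneg _ _ _
  have hc1q : 0 ≤ B6.c1 dq q.δ₀ q.α := c1_nonneg _ _ _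
  have htwo_p : 0 ≤ twoConst dp p.δ₀ p.α p.N2 p.B2 p.N' p.θ2 (p.C dp) L₀ := by
    have := hp.N2_nn; have := hp.B2_nn; have := hp.N'_nn; have := hp.θ2_nn
    unfold twoConst; positivity
  have htwo_q : 0 ≤ twoConst dq q.δ₀ q.α q.N2 q.B2 q.NF q.θ2 (q.C dq) L₀ := by
    have := hq.N2_nn; have := hq.B2_nn; have := hq.NF_nn; have := hq.θ2_nn
    unfold twoConst; positivity
  have hhold_p : ∀ β, 0 ≤ β → β < 1 → 0 ≤ holderConst dp p.δ₀ p.α p.NH p.N' (p.C dp) (p.Bl β) (p.Bt β) := by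
    intro β h0 h1
    have := hp.NH_nn; have := hp.N'_nn; have := hp.Bl_nn β h0 h1; have := hp.Bt_nn β h0 h1
    unfold holderConst; positivity
  have hhold_q : ∀ β, 0 ≤ β → β < 1 → 0 ≤ holderConst dq q.δ₀ q.α q.NH q.NF (q.C dq) (q.Bl β) (q.Bt β) := by
    intro β h0 h1
    have := hq.NH_nn; have := hq.NF_nn; have := hq.Bl_nn β h0 h1; have := hq.Bt_nn β h0 h1
    unfold holderConst; positivity
  have hin44_p : ∀ ε, 0 < ε → ε ≤ 1 → 0 ≤ inputConst44 dp p.δ₀ p.α p.NI p.N' (p.C dp) L₀ (p.BI ε) (p.θI ε) := by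
    intro ε h0 h1
    have := hp.NI_nn; have := hp.N'_nn; have := hp.BI_nn ε h0 h1; have := hp.θI_nn ε h0
    unfold inputConst44; positivity
  have hin44_q : ∀ ε, 0 < ε → ε ≤ 1 → 0 ≤ inputConst44 dq q.δ₀ q.α q.NI q.NF (q.C dq) L₀ (q.BI ε) (q.θI ε) := by
    intro ε h0 h1
    have := hq.NI_nn; have := hq.NF_nn; have := hq.BI_nn ε h0 h1; have := hq.θI_nn ε h0
    unfold inputConst44; positivity
  have hin45_p : ∀ ε β, 0 < ε → ε ≤ 1 → 0 ≤ β → β < 1 →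
      0 ≤ inputConst45 dp p.δ₀ p.α p.NI p.N' L₀ (holderConst dp p.δ₀ p.α p.NH p.N' (p.C dp) (p.Bl β) (p.Bt β)) (p.BI2 ε β)
        (p.θI (β + ε)) := by
    intro ε β h0 h1 hβ0 hβ1
    have := hp.NI_nn; have := hp.N'_nn; have := hp.BI2_nn ε β h0 h1 hβ0 hβ1; have := hp.θI_nn (β + ε) (by linarith)
    have := hhold_p β hβ0 hβ1
    unfold inputConst45; positivity
  have hin45_q : ∀ ε β, 0 < ε → ε ≤ 1 → 0 ≤ β → β < 1 →
      0 ≤ inputConst45 dq q.δ₀ q.α q.NI q.NF L₀ (holderConst dq q.δ₀ q.α q.NH q.NF (q.C dq) (q.Bl β) (q.Bt β)) (q.BI2 ε β)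
        (q.θI (β + ε)) := by
    intro ε β h0 h1 hβ0 hβ1
    have := hq.NI_nn; have := hq.NF_nn; have := hq.BI2_nn ε β h0 h1 hβ0 hβ1; have := hq.θI_nn (β + ε) (by linarith)
    have := hhold_q β hβ0 hβ1
    unfold inputConst45; positivity
  obtain ⟨t37, c38⟩ := thm37_cor38_complete_geo9Y_nbr (bg := bg) (B₁ := s * B1Y p q dp dFp dq dFq L₀)
    (δ₁ := delta1Y p q) (Bβ := fun β => s * BbetaY p q dp dq β) (Bε := fun ε => s * BepsY p q dp dq L₀ ε)
    (Bεβ := fun ε β => s * BepsbetaY p q dp dq L₀ ε β) 𝔬 rd H 𝔭 bH K ev evY Rel m Cev mN hRlen hRd₁ hRd₂ hmult hnbr hCev κ SH SL SI S2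
    p.Bl p.Bt p.BI p.θI p.BI2 p.α p.ρ p.Nc p.N' p.Cℓ p.Kc p.θ₀ p.B₀ p.δ₀ p.a₁ p.M₁ p.αF p.NH p.NL p.BL p.NI p.N2 p.B2 p.θ2 hc
    hp.α_pos hp.α_lt hp.Nc_nn hp.N'_nn hp.one_le_Cℓ hp.Kc_nn hp.θ₀_nn hp.B₀_pos hp.δ₀_pos hp.a₁_pos hp.M₁_pos hp.αF_pos
    hp.αF_lt.le hp.NH_nn hp.NL_nn hp.BL_nn hp.NI_nn hp.N2_nn hp.B2_nn hp.θ2_nn hst hκ hrd hloc h36 h36H hco0 hco1 hco2 hco3 hgl0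
    hgl1 hgl2 hgl3 hl0 hl1 hl2 hl3 hl4 hl5 hH1 hIR hsym htr hadjL hcntH hcntL hcntI hcnt2 hp.Bl_nn hp.Bt_nn hp.BI_nn hp.BI2_nn
    hp.θI_nn (scK hm0 hsm hCp ((le_pinLowerB₁' _ _ _ _ _).trans hBp))
    (scK hAe0 hsL2 (mul_nonneg hCp hL₀0) ((le_pinLowerB₂' _ _ _ _ _).trans hBp)) hδ1.le (min_le_left _ _)
    (sc0 ((le_pinLowerB₃' _ _ _ _ _).trans hBp) hB1)
    (scK hAe0 hsL2 (mul_nonneg (Real.sqrt_nonneg _) hL₀0) ((le_pinLowerB₄' _ _ _ _ _).trans hBp))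
    (scK hAe0 hsL2 htwo_p ((le_pinLowerB₅' _ _ _ _ _).trans hBp))
    (fun β h0 h1 => scK hmLe0 hsmL (hhold_p β h0 h1) (le_max_left _ _))
    (fun ε h0 h1 => scK he0 hse (hin44_p ε h0 h1) (le_max_left _ _))
    (fun ε β h0 h1 hβ0 hβ1 => scK hLe0 hsLe (hin45_p ε β h0 h1 hβ0 hβ1) (le_max_left _ _))
  have t310 := thm310_complete_geo9Y_nbr (bg := bg) (B₁ := s * B1Y p q dp dFp dq dFq L₀) (δ₁ := delta1Y p q)
    (Bβ := fun β => s * BbetaY p q dp dq β) (Bε := fun ε => s * BepsY p q dp dq L₀ ε)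
    (Bεβ := fun ε β => s * BepsbetaY p q dp dq L₀ ε β) 𝔬A rdA H 𝔭A bHA KA evA evYA Rel m Cev mN hRlen hRd₁ hRd₂ hmult hnbr hCev
    κA SHA SLA SIA S2A q.Bl q.Bt q.BI q.θI q.BI2 q.α q.ρ q.Nc q.N' q.NF q.Cℓ q.Kc q.θ₀ q.B₀ q.δ₀ q.a₁ q.M₁ q.αF q.NH q.NL q.BL q.NI
    q.N2 q.B2 q.θ2 hc hq.α_pos hq.α_lt hq.Nc_nn hq.N'_nn hq.NF_nn hq.one_le_Cℓ hq.Kc_nn hq.θ₀_nn hq.B₀_pos hq.δ₀_pos hq.a₁_pos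
    hq.M₁_pos hq.αF_pos hq.αF_lt.le hq.NH_nn hq.NL_nn hq.BL_nn hq.NI_nn hq.N2_nn hq.B2_nn hq.θ2_nn hstA hκA hrdA hlocA h36A h36HA
    hcoA0 hcoA1 hcoA2 hcoA3 hglA0 hglA1 hglA2 hglA3 hlA0 hlA1 hlA2 hlA3 hlA4 hlA5 hH1A hIRA hsymA htrA hadjLA hcntHA hcntLA hcntIA
    hcnt2A hq.Bl_nn hq.Bt_nn hq.BI_nn hq.BI2_nn hq.θI_nn
    (scK hm0 hsm hCq ((le_pinLowerB₁' _ _ _ _ _).trans hBq))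
    (scK hAe0 hsL2 (mul_nonneg hCq hL₀0) ((le_pinLowerB₂' _ _ _ _ _).trans hBq)) hδ1.le (min_le_right _ _)
    (sc0 ((le_pinLowerB₃' _ _ _ _ _).trans hBq) hB1)
    (scK hAe0 hsL2 (mul_nonneg (Real.sqrt_nonneg _) hL₀0) ((le_pinLowerB₄' _ _ _ _ _).trans hBq))
    (scK hAe0 hsL2 htwo_q ((le_pinLowerB₅' _ _ _ _ _).trans hBq))
    (fun β h0 h1 => scK hmLe0 hsmL (hhold_q β h0 h1) (le_max_right _ _))
    (fun ε h0 h1 => scK he0 hse (hin44_q ε h0 h1) (le_max_right _ _))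
    (fun ε β h0 h1 hβ0 hβ1 => scK hLe0 hsLe (hin45_q ε β h0 h1 hβ0 hβ1) (le_max_right _ _))
  exact ⟨t37, c38, t310, rwSumsYieldIneqs_allPins _ 𝔬 (fun _ => 1) H _ _ 𝔬A rdA (fun _ => 1) H _ _ K KA _ _ _
    (mul_pos (lt_of_lt_of_le one_pos hs1) (B1Y_pos p q dp dFp dq dFq L₀)) (delta1Y_pos hp hq)⟩

end StageY

end

end Literature.MathematicalPhysics.QuantumFieldTheory.Balaban1983to89.B9RWSumsDefinitePinsNbr
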